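import Mathlib
import Summits.KontsevichZagierPeriods.Zeta5Search.BrickBlockWeight
import Summits.KontsevichZagierPeriods.Zeta5Search.BrickWeightLocality
import Summits.KontsevichZagierPeriods.Zeta5Search.BrickDigitSideZero

/-!
# BrickPropositionH — zi-p2's PROPOSITION H° (every level `ℓ ≤ A`) and DIGIT THEOREM 8⁺ in kernel:
`v(Σ_{k≤M} g(k)·r̃_k^{(s)}(M)) ≥ ℓ` for admissible `g`, and `v(Σ_{j≤n} u(j)·r_j^{(s)}(n)) ≥ L(n)` for the
Ball/Rivoal brick kernels at every level `L(n) ≤ A` (cell zeta5-irr)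

HONEST FRAMING: systematic search; no irrationality claim unless certified. INSTRUMENT theorems of the ζ(5)
census cell zeta5-irr (HOME `run/shared/lean/pub/zeta5-irr/`; memo `zi-p2/probes/B8/thm8/THEOREM8.md` §1–§2
«PROPOSITION H°. For every row M of R̃ with ℓ := L(M) ≤ A − B, every admissible weight g ((S_ℓ) g(M−k) + g(k) ≡ 0
(mod p^ℓ), (D) g(k*) ≡ g(k) (mod p^e) for k* ≡ k (mod p^e), e ≤ ℓ) and every s ∈ {0} ∪ [1,A]: v(Σ_{k=0}^{M}
g(k)·r̃_k^{(s)}(M)) ≥ ℓ» and «DIGIT THEOREM 8. For every n ≥ p with 1 ≤ L(n) ≤ A − B and every s: v(Σ_{j=0}^{n}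
u(j)·r_j^{(s)}(n)) ≥ L(n)»; `ADDENDUM-8plus.md` (THEOREM 8⁺: the same for every `ℓ, L(n) ≤ A`); graded zi-ref R6.23
PASS as THEOREM/PROPOSITION, ADDENDUM 8⁺ PASS as READING-COROLLARY). Here the ranges are those of THEOREM 8⁺
(`ℓ ≤ A`), and the normalisation exponent is the nominal level: row `M < p^{ℓ+1}` with `p^{ℓ(A−s)}` (for `M` of exact
level `ℓ` this is zi-p2's `r̃^{(s)}`; smaller `M` are covered too). Nothing here is about ζ(5); no irrationality content;
filing moves no rung. Filed by the engine seat zi-eng (g9); inputs `BrickLevelReduction` (steps (1)(2)),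
`BrickBlockWeight` (steps (3)(4)), `BrickWeightLocality` (LEMMA 4), `BrickTopKummer.cell_integral_of_lt` /
`BrickDigitSideZero.cellZero_integral_of_lt` (level `0`).

## The statements (`p` odd prime — `p ≥ 5` for the digit theorem —, `A` even, `1 ≤ B`, `2B ≤ A`)

* ADMISSIBLE weights for the row `M` at level `ℓ` (zi-p2's (S_ℓ), (D); spelled out as three hypotheses, no
  definition): `g ∈ ℤ_(p)` on `[0,M]`, `v(g(M−k) + g(k)) ≤ exp(−ℓ)`, `v(g(k') − g(k)) ≤ exp(−e)` for `p^e ∣ k − k'`,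
  `1 ≤ e ≤ ℓ`.
* `level_step`: the induction step for either kernel `ε ≤ 1` (reduction + block weight + hypothesis at level `L`).
* **`propositionH`**: for `ℓ ≤ A`, `M < p^{ℓ+1}`, `g` admissible: `v(Σ_{k≤M} g(k)·p^{ℓ(A−s)}c̃_{k,s}(M)) ≤ exp(−ℓ)`
  for every `s`, and `v(Σ_{k≤M} g(k)·p^{ℓA}cell̃^{(0)}_k(M)) ≤ exp(−ℓ)`.
* **`digitTheorem`**, **`digitTheorem_zero`** (DIGIT THEOREM 8⁺, `p ≥ 5`): for `L + 1 ≤ A`, `n < p^{L+2}`: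
  `v(Σ_{j≤n} u_n(j)·p^{(L+1)(A−s)}c_{j,s}(n)) ≤ exp(−(L+1))` (`u = BrickWeightLocality.phiWeight`), cells `s ≥ 1`
  and the harmonic cell.
-/

namespace Summit.KontsevichZagierPeriods.Zeta5Search.BrickPropositionH

open Finset Nat WithZero
open Summit.KontsevichZagierPeriods.Zeta5Search.BrickTopCoefficient (cTop)
open Summit.KontsevichZagierPeriods.Zeta5Search.BrickLaurent (cell)
open Summit.KontsevichZagierPeriods.Zeta5Search.BrickPartialFractions (cellZero)
open Summit.KontsevichZagierPeriods.Zeta5Search.BrickTopKummer (cell_integral_of_lt)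
open Summit.KontsevichZagierPeriods.Zeta5Search.BrickDigitSideZero (cellZero_integral_of_lt)
open Summit.KontsevichZagierPeriods.Zeta5Search.BrickLevelReduction (blockWeight level_reduction level_reduction_zero)
open Summit.KontsevichZagierPeriods.Zeta5Search.BrickBlockWeight (blockWeight_le blockWeight_reflect_add_le
  blockWeight_local)
open Summit.KontsevichZagierPeriods.Zeta5Search.BrickWeightLocality (phiWeight padicValuation_phiWeight_le
  phiWeight_reflect padicValuation_phiWeight_sub_le)

noncomputable section

variable {p : ℕ} [Fact p.Prime]

/-- Division by `p` raises the valuation bound by one: `v(x) ≤ exp(m) ⇒ v(x/p) ≤ exp(m+1)`. -/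
theorem padicValuation_div_prime_le {x : ℚ} {m : ℤ} (h : Rat.padicValuation p x ≤ exp m) :
    Rat.padicValuation p (x / p) ≤ exp (m + 1) := by
  rw [map_div₀, Rat.padicValuation_self, div_le_iff₀ (zero_lt_iff.2 exp_ne_zero), ← exp_add]
  simpa using h

/-! ## The induction step (either kernel) -/

section step

variable (hp2 : p ≠ 2) {A B ε N n₀ L : ℕ} (hA : Even A) (hB : 1 ≤ B) (hAB : 2 * B ≤ A) (hε : ε ≤ 1)
  (hn₀ : n₀ < p) (hN : N < p ^ (L + 1)) (hLA : L + 1 ≤ A) {g : ℕ → ℚ}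
  (hgI : ∀ k, k ≤ n₀ + N * p → Rat.padicValuation p (g k) ≤ 1)
  (hgS : ∀ k, k ≤ n₀ + N * p →
    Rat.padicValuation p (g (n₀ + N * p - k) + (-1) ^ ε * g k) ≤ exp (-((L : ℤ) + 1)))
  (hgD : ∀ e k k', 1 ≤ e → e ≤ L + 1 → k ≤ n₀ + N * p → k' ≤ n₀ + N * p → (p : ℤ) ^ e ∣ (k : ℤ) - k' →
    Rat.padicValuation p (g k' - g k) ≤ exp (-(e : ℤ)))
  (IH : ∀ g' : ℕ → ℚ, (∀ K, K ≤ N → Rat.padicValuation p (g' K) ≤ 1) →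
    (∀ K, K ≤ N → Rat.padicValuation p (g' (N - K) + g' K) ≤ exp (-(L : ℤ))) →
    (∀ e K K', 1 ≤ e → e ≤ L → K ≤ N → K' ≤ N → (p : ℤ) ^ e ∣ (K : ℤ) - K' →
      Rat.padicValuation p (g' K' - g' K) ≤ exp (-(e : ℤ))) →
    (∀ s, Rat.padicValuation p (∑ K ∈ range (N + 1), g' K * ((p : ℚ) ^ (L * (A - s)) * cell A B 0 N K s)) ≤
      exp (-(L : ℤ))) ∧
    Rat.padicValuation p (∑ K ∈ range (N + 1), g' K * ((p : ℚ) ^ (L * A) * cellZero A B 0 N K)) ≤ exp (-(L : ℤ)))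
include hp2 hA hB hAB hε hn₀ hN hLA hgI hgS hgD IH

/-- **THE INDUCTION STEP** (zi-p2 THEOREM 8 §2 (1)–(5), either kernel): if the conclusion of PROPOSITION H° holds at
level `L` for the row `N` and every admissible weight, then for the row `n = n₀ + Np` (kernel `ε ≤ 1`) and every
weight `g` satisfying (I), (S_ε), (D) at level `L+1`: `v(Σ_{k≤n} g(k)·r_k^{(s)}(n)) ≥ L+1`, all `s`, and the same
for the harmonic cell — via `W = p·ω` with `ω = blockWeight/p` admissible for `N` at level `L`. -/
theorem level_step :
    (∀ s, Rat.padicValuation p (∑ k ∈ range (n₀ + N * p + 1),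
      g k * ((p : ℚ) ^ ((L + 1) * (A - s)) * cell A B ε (n₀ + N * p) k s)) ≤ exp (-((L : ℤ) + 1))) ∧
    Rat.padicValuation p (∑ k ∈ range (n₀ + N * p + 1),
      g k * ((p : ℚ) ^ ((L + 1) * A) * cellZero A B ε (n₀ + N * p) k)) ≤ exp (-((L : ℤ) + 1)) := by
  have hp : p.Prime := Fact.out
  have hpQ : (p : ℚ) ≠ 0 := by exact_mod_cast hp.ne_zero
  set W : ℕ → ℚ := blockWeight A B ε p n₀ N g with hW
  set ω : ℕ → ℚ := fun K => W K / p with hω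
  -- `ω` is admissible for `N` at level `L`
  have hωI : ∀ K, K ≤ N → Rat.padicValuation p (ω K) ≤ 1 := fun K hK => by
    have h := padicValuation_div_prime_le (p := p) (blockWeight_le hp2 hA hB hε hn₀ hgI hgS hgD hK)
    rwa [show (-1 : ℤ) + 1 = 0 by norm_num, exp_zero] at h
  have hωS : ∀ K, K ≤ N → Rat.padicValuation p (ω (N - K) + ω K) ≤ exp (-(L : ℤ)) := fun K hK => by
    rw [hω]
    simp only
    rw [← add_div]
    have h := padicValuation_div_prime_le (p := p)
      (blockWeight_reflect_add_le hp2 (B := B) hA hε hn₀ (L := L) hgS hK)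
    rwa [show -((L : ℤ) + 1) + 1 = -(L : ℤ) by ring] at h
  have hωD : ∀ e K K', 1 ≤ e → e ≤ L → K ≤ N → K' ≤ N → (p : ℤ) ^ e ∣ (K : ℤ) - K' →
      Rat.padicValuation p (ω K' - ω K) ≤ exp (-(e : ℤ)) := fun e K K' he heL hK hK' hdvd => by
    rw [hω]
    simp only
    rw [← sub_div]
    have h := padicValuation_div_prime_le (p := p)
      (blockWeight_local hp2 (B := B) (ε := ε) hA hn₀ (L := L) hgI hgD he heL hK hK' hdvd)
    rwa [show -((e : ℤ) + 1) + 1 = -(e : ℤ) by ring] at h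
  obtain ⟨IHs, IH0⟩ := IH ω hωI hωS hωD
  have hWω : ∀ K, W K = (p : ℚ) * ω K := fun K => by rw [hω]; simp only; rw [mul_div_cancel₀ _ hpQ]
  have hpv : Rat.padicValuation p (p : ℚ) = exp (-1 : ℤ) := Rat.padicValuation_self p
  refine ⟨fun s => ?_, ?_⟩
  · have hred := level_reduction hp2 hAB hε hn₀ hN hLA hgI s
    have hmain : Rat.padicValuation p (∑ K ∈ range (N + 1),
        blockWeight A B ε p n₀ N g K * ((p : ℚ) ^ (L * (A - s)) * cell A B 0 N K s)) ≤ exp (-((L : ℤ) + 1)) := by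
      rw [← hW, show ∑ K ∈ range (N + 1), W K * ((p : ℚ) ^ (L * (A - s)) * cell A B 0 N K s) =
        (p : ℚ) * ∑ K ∈ range (N + 1), ω K * ((p : ℚ) ^ (L * (A - s)) * cell A B 0 N K s) by
          rw [Finset.mul_sum]; exact Finset.sum_congr rfl fun K _ => by rw [hWω K]; ring, map_mul, hpv]
      calc _ ≤ exp (-1 : ℤ) * exp (-(L : ℤ)) := mul_le_mul' le_rfl (IHs s)
        _ = _ := by rw [← exp_add]; congr 1; ring
    have h := Valuation.map_add_le _ hred hmain
    rwa [sub_add_cancel] at h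
  · have hred := level_reduction_zero hp2 hAB hε hn₀ hN hLA hgI
    have hmain : Rat.padicValuation p (∑ K ∈ range (N + 1),
        blockWeight A B ε p n₀ N g K * ((p : ℚ) ^ (L * A) * cellZero A B 0 N K)) ≤ exp (-((L : ℤ) + 1)) := by
      rw [← hW, show ∑ K ∈ range (N + 1), W K * ((p : ℚ) ^ (L * A) * cellZero A B 0 N K) =
        (p : ℚ) * ∑ K ∈ range (N + 1), ω K * ((p : ℚ) ^ (L * A) * cellZero A B 0 N K) by
          rw [Finset.mul_sum]; exact Finset.sum_congr rfl fun K _ => by rw [hWω K]; ring, map_mul, hpv]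
      calc _ ≤ exp (-1 : ℤ) * exp (-(L : ℤ)) := mul_le_mul' le_rfl IH0
        _ = _ := by rw [← exp_add]; congr 1; ring
    have h := Valuation.map_add_le _ hred hmain
    rwa [sub_add_cancel] at h

end step

/-! ## PROPOSITION H° -/

/-- **PROPOSITION H°** (zi-p2 THEOREM 8, in the range of THEOREM 8⁺): for an odd prime `p`, `A` even, `1 ≤ B`,
`2B ≤ A`, every level `ℓ ≤ A`, every row `M < p^{ℓ+1}` of the symmetric kernel and every admissible weight `g`:
`v(Σ_{k≤M} g(k)·p^{ℓ(A−s)}·c̃_{k,s}(M)) ≤ exp(−ℓ)` for every `s`, and `v(Σ_{k≤M} g(k)·p^{ℓA}·cell̃^{(0)}_k(M)) ≤ exp(−ℓ)`. -/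
theorem propositionH (hp2 : p ≠ 2) {A B : ℕ} (hA : Even A) (hB : 1 ≤ B) (hAB : 2 * B ≤ A) :
    ∀ ℓ : ℕ, ℓ ≤ A → ∀ M : ℕ, M < p ^ (ℓ + 1) → ∀ g : ℕ → ℚ, (∀ k, k ≤ M → Rat.padicValuation p (g k) ≤ 1) →
      (∀ k, k ≤ M → Rat.padicValuation p (g (M - k) + g k) ≤ exp (-(ℓ : ℤ))) →
      (∀ e k k', 1 ≤ e → e ≤ ℓ → k ≤ M → k' ≤ M → (p : ℤ) ^ e ∣ (k : ℤ) - k' →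
        Rat.padicValuation p (g k' - g k) ≤ exp (-(e : ℤ))) →
      (∀ s, Rat.padicValuation p (∑ k ∈ range (M + 1), g k * ((p : ℚ) ^ (ℓ * (A - s)) * cell A B 0 M k s)) ≤
        exp (-(ℓ : ℤ))) ∧
      Rat.padicValuation p (∑ k ∈ range (M + 1), g k * ((p : ℚ) ^ (ℓ * A) * cellZero A B 0 M k)) ≤ exp (-(ℓ : ℤ)) := by
  have hp : p.Prime := Fact.out
  intro ℓ
  induction ℓ with
  | zero =>
    intro _ M hM g hgI _ _
    rw [zero_add, pow_one] at hM
    simp only [Nat.cast_zero, neg_zero, exp_zero, zero_mul, pow_zero, one_mul]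
    refine ⟨fun s => Valuation.map_sum_le _ fun k hk => ?_, Valuation.map_sum_le _ fun k hk => ?_⟩
    · have hk' : k ≤ M := by have := mem_range.1 hk; omega
      rw [map_mul]; exact mul_le_one' (hgI k hk') (cell_integral_of_lt hp2 hAB hM hk' (Or.inr rfl) s)
    · have hk' : k ≤ M := by have := mem_range.1 hk; omega
      rw [map_mul]; exact mul_le_one' (hgI k hk') (cellZero_integral_of_lt hp2 hAB hM hk')
  | succ L ih =>
    intro hLA M hM g hgI hgS hgD
    obtain ⟨n₀, N, hn₀, rfl⟩ : ∃ n₀ N, n₀ < p ∧ M = n₀ + N * p :=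
      ⟨M % p, M / p, Nat.mod_lt _ hp.pos, (Nat.mod_add_div' M p).symm⟩
    have hN : N < p ^ (L + 1) := by
      rw [Nat.lt_iff_add_one_le]
      by_contra h
      have h' : p ^ (L + 1) ≤ N := by omega
      have : p ^ (L + 1 + 1) ≤ n₀ + N * p := by
        calc p ^ (L + 1 + 1) = p ^ (L + 1) * p := pow_succ _ _
          _ ≤ N * p := Nat.mul_le_mul_right _ h'
          _ ≤ n₀ + N * p := Nat.le_add_left _ _
      omega
    have hgS' : ∀ k, k ≤ n₀ + N * p →
        Rat.padicValuation p (g (n₀ + N * p - k) + (-1) ^ 0 * g k) ≤ exp (-((L : ℤ) + 1)) := fun k hk => by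
      rw [pow_zero, one_mul]; exact_mod_cast hgS k hk
    have h := level_step hp2 hA hB hAB (ε := 0) (Nat.zero_le 1) hn₀ hN hLA hgI hgS'
      (fun e k k' he heL hk hk' hdvd => hgD e k k' he (by omega) hk hk' hdvd)
      (fun g' h1 h2 h3 => ih (by omega) N hN g' h1 h2 h3)
    exact_mod_cast h

/-! ## DIGIT THEOREM 8⁺ -/

section digit

variable (hp3 : 3 < p) {A B L n : ℕ} (hA : Even A) (hB : 1 ≤ B) (hAB : 2 * B ≤ A) (hLA : L + 1 ≤ A)
  (hn : n < p ^ (L + 1 + 1))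
include hp3 hA hB hAB hLA hn

/-- **DIGIT THEOREM 8⁺** (zi-p2; `p ≥ 5`, `A` even, `1 ≤ B`, `2B ≤ A`, `L + 1 ≤ A`, `n < p^{L+2}`): with the weight
`u_n(j) = (Φ_{n,p}(−j) − 1)/p³` and the level-`(L+1)` residues `r_j^{(s)}(n) = p^{(L+1)(A−s)}c_{j,s}(n)` of the full
kernel: `v(Σ_{j≤n} u_n(j)·r_j^{(s)}(n)) ≤ exp(−(L+1))` for every `s`, together with the harmonic cell. -/
theorem digitTheorem_all :
    (∀ s, Rat.padicValuation p (∑ j ∈ range (n + 1),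
      phiWeight A B p n j * ((p : ℚ) ^ ((L + 1) * (A - s)) * cell A B 1 n j s)) ≤ exp (-((L : ℤ) + 1))) ∧
    Rat.padicValuation p (∑ j ∈ range (n + 1),
      phiWeight A B p n j * ((p : ℚ) ^ ((L + 1) * A) * cellZero A B 1 n j)) ≤ exp (-((L : ℤ) + 1)) := by
  have hp : p.Prime := Fact.out
  have hp2 : p ≠ 2 := by omega
  obtain ⟨n₀, N, hn₀, rfl⟩ : ∃ n₀ N, n₀ < p ∧ n = n₀ + N * p :=
    ⟨n % p, n / p, Nat.mod_lt _ hp.pos, (Nat.mod_add_div' n p).symm⟩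
  have hN : N < p ^ (L + 1) := by
    rw [Nat.lt_iff_add_one_le]
    by_contra h
    have h' : p ^ (L + 1) ≤ N := by omega
    have : p ^ (L + 1 + 1) ≤ n₀ + N * p := by
      calc p ^ (L + 1 + 1) = p ^ (L + 1) * p := pow_succ _ _
        _ ≤ N * p := Nat.mul_le_mul_right _ h'
        _ ≤ n₀ + N * p := Nat.le_add_left _ _
    omega
  refine level_step hp2 hA hB hAB (ε := 1) le_rfl hn₀ hN hLA (g := fun k : ℕ => phiWeight A B p (n₀ + N * p) k)
    (fun k _ => padicValuation_phiWeight_le hp3 hAB _ _) (fun k hk => ?_) (fun e k k' _ _ _ _ hdvd => ?_)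
    (fun g' h1 h2 h3 => propositionH hp2 hA hB hAB L (by omega) N hN g' h1 h2 h3)
  · rw [pow_one, neg_one_mul, ← sub_eq_add_neg, phiWeight_reflect hp2 A B hk, sub_self, map_zero]
    exact _root_.zero_le
  · exact padicValuation_phiWeight_sub_le hp3 hAB _ hdvd

/-- **DIGIT THEOREM 8⁺, cells `s ≥ 1`** (and every `s`): `v(Σ_{j≤n} u_n(j)·p^{(L+1)(A−s)}c_{j,s}(n)) ≤ exp(−(L+1))`. -/
theorem digitTheorem (s : ℕ) :
    Rat.padicValuation p (∑ j ∈ range (n + 1),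
      phiWeight A B p n j * ((p : ℚ) ^ ((L + 1) * (A - s)) * cell A B 1 n j s)) ≤ exp (-((L : ℤ) + 1)) :=
  (digitTheorem_all hp3 hA hB hAB hLA hn).1 s

/-- **DIGIT THEOREM 8⁺, harmonic cell**: `v(Σ_{j≤n} u_n(j)·p^{(L+1)A}cell^{(0)}_j(n)) ≤ exp(−(L+1))`. -/
theorem digitTheorem_zero :
    Rat.padicValuation p (∑ j ∈ range (n + 1),
      phiWeight A B p n j * ((p : ℚ) ^ ((L + 1) * A) * cellZero A B 1 n j)) ≤ exp (-((L : ℤ) + 1)) :=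
  (digitTheorem_all hp3 hA hB hAB hLA hn).2

end digit

end

end Summit.KontsevichZagierPeriods.Zeta5Search.BrickPropositionH
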